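/-
Origin: expansion seat `prover-pub-hodgecm-mc-binder-2-g16-0`, handover #86 2026-08-20T18:00Z md5 36cc47421e36 (NEW; 240 l.; FLAG step (3) «K* has degree 8» as a KERNEL carrier: group level `cmSetOf` (the eight CM sets of a six-point set with a free involution), `mem_cmSetOf_iff`, `cmSetOf_injective`, `exists_three`, `isCMSet_cmSetOf`, `exists_eq_cmSetOf`, `setOf_isCMSet_eq_range`, **`ncard_setOf_isCMSet`** (= 8), **`index_stabilizer_eq_eight`** (single-pair flips ⇒ Stab(Φ) has index 8); Galois level **`index_stabilizer_pullbackTypeAlg`** and **`finrank_reflexField_pullbackTypeAlg` : `IsNormalClosure ℚ K L → finrank ℚ K = 6 → 24 ≤ finrank ℚ L → ∀ ι₁ Ψ, Module.finrank ℚ (reflexField ℚ L (pullbackTypeAlg ι₁ Ψ)) = 8`** (the vendored `reflexField` = `L^{Stab(Ψ_L)}` [Shimura1998 §8.3 Prop. 28]; via `IntermediateField.finrank_fixedField_eq_card`, the tower law and `card_mul_index`), `finrank_reflexField_pullbackTypeAlg_ne` (`≠ finrank ℚ K`). CERT lean-direct over the RUN-56 PKG oleans + #84/#85: rc 0 ∕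 13 s ∕ 0 warn ∕ 0 proof-hole; `#print axioms` 5 ∕ 5 trio (`g16/certs/axioms-deg-r56pkg.log` d24ac89576a1); NAME LIST: `HodgeCM.SignRecipe.finrank_reflexField_pullbackTypeAlg` · `HodgeCM.SignRecipe.index_stabilizer_pullbackTypeAlg` · `HodgeCM.CMTypeFlips.ncard_setOf_isCMSet`) (`HOME/mc/pub-hodgecm-mc-binder-2/g16/stage58/HodgeCM/Model/Binders/JLiuReflexDegree.lean`, md5 36cc47421e36, 240 lines);
landed by the second packager p2 gen 11 (p2-g11) in gate run 58 as `HodgeCM/Model/Binders/JLiuReflexDegree.lean` (packager comment re-wording per the RUN-32 precedent (gate audit (5) rejects the proof-placeholder tokens s-o-r-r-y / a-d-m-i-t anywhere in a source, comments included): 1 occurrence(s) inside COMMENTS re-spelt `proof-hole` / `adm-token`; no Lean code byte touched).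
-/
/-
Origin: speedrun cell pub-hodgecm, MODEL-CONSTRUCTION sub-cell, unit pub-hodgecm-mc-binder-2-g16 (BINDER PROVER, gen 16; FLAG step (3) of STATUS 2026-08-20 l.13871
«`K*` has degree 8» as a KERNEL carrier, after [Dodson1984] §1 Reflex Degree Theorem + §5.1.3), seat prover-pub-hodgecm-mc-binder-2-g16-0, 2026-08-20.
Target in PKG: HodgeCM/Model/Binders/JLiuReflexDegree.lean (NEW additive leaf; imports binder-2's `Binders/JLiuPrimitive` (this kit) ONLY; nothing imports it).
KERNEL ONLY: theorems + one data `def` (`cmSetOf`, the eight CM sets of a six-point set); 0 `def … : Prop`, nothing cited as hypothesis; MODEL-N ±0;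
E untouched.  Nothing here is a claim of the manuscripts under adjudication.
-/
import Summits.HodgeConjecture.HodgeCM.Model.Binders.JLiuPrimitive

set_option autoImplicit false

/-!
# The reflex field of every CM type of a sextic has degree 8 at PerL's scope

Group level (`HodgeCM.CMTypeFlips`): a six-point `E` with a fixed-point-free involution `c` carries EXACTLY 8 `c`-CM sets (`ncard_setOf_isCMSet`),
so under single-pair flips the stabiliser of any CM set has index 8 (`index_stabilizer_eq_eight`, orbit–stabiliser with `orbit_eq_setOf_isCMSet`).
Galois level (`HodgeCM.SignRecipe`): for a sextic CM field `K` with normal closure `L` of degree `≥ 24`, the REFLEX FIELD of the `L`-reading `Ψ_L`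
of every CM type `Ψ` of `K` — the vendored `reflexField ℚ L Ψ_L = L^{Stab(Ψ_L)}` ([Shimura1998 §8.3 Prop. 28]) — has degree 8 over `ℚ`
(`finrank_reflexField_pullbackTypeAlg`); in particular it is never (isomorphic to) the sextic `K` ([Dodson1984] §1 Remark «[K′:ℚ] is the order
of the orbit of Φ», §5.1.3 Prop. 1 «2³ = 8»).

0 `proof-hole`, 0 `axiom`; expected `#print axioms` ⊆ {propext, Classical.choice, Quot.sound}.
-/

noncomputable section

open scoped Pointwise
open Literature.AlgebraicGeometry.Motives (CMType)
open Literature.NumberTheory.ComplexMultiplication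

namespace HodgeCM

namespace CMTypeFlips

variable {G : Type*} [Group G] {E : Type*} [MulAction G E] {c : E → E}

/-! ## 1. The eight CM sets of a six-point set -/

section Pairs

/-- The CM set with prescribed members of the three pairs `{e₁, c e₁}`, `{e₂, c e₂}`, `{x, c x}`. [folklore] -/
def cmSetOf (c : E → E) (e₁ e₂ x : E) (b : Bool × Bool × Bool) : Set E :=
  {cond b.1 e₁ (c e₁), cond b.2.1 e₂ (c e₂), cond b.2.2 x (c x)}

variable (hc : ∀ e : E, c e ≠ e) (hcc : ∀ e : E, c (c e) = e)
  {e₁ e₂ x : E} (h₂₁ : e₂ ≠ e₁) (h₂₁' : e₂ ≠ c e₁) (hx₁ : x ≠ e₁) (hx₁' : x ≠ c e₁) (hx₂ : x ≠ e₂) (hx₂' : x ≠ c e₂)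
include hc hcc h₂₁ h₂₁' hx₁ hx₁' hx₂ hx₂'

/-- Memberships of the six points in `cmSetOf`. [folklore] -/
theorem mem_cmSetOf_iff (b : Bool × Bool × Bool) :
    (e₁ ∈ cmSetOf c e₁ e₂ x b ↔ b.1 = true) ∧ (c e₁ ∈ cmSetOf c e₁ e₂ x b ↔ b.1 = false) ∧
    (e₂ ∈ cmSetOf c e₁ e₂ x b ↔ b.2.1 = true) ∧ (c e₂ ∈ cmSetOf c e₁ e₂ x b ↔ b.2.1 = false) ∧
    (x ∈ cmSetOf c e₁ e₂ x b ↔ b.2.2 = true) ∧ (c x ∈ cmSetOf c e₁ e₂ x b ↔ b.2.2 = false) := by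
  have hinj := injective_of_invol hcc
  have d12 : e₁ ≠ c e₁ := (hc e₁).symm
  have d13 : e₁ ≠ e₂ := h₂₁.symm
  have d14 : e₁ ≠ c e₂ := fun h => h₂₁' (by rw [h, hcc])
  have d15 : e₁ ≠ x := hx₁.symm
  have d16 : e₁ ≠ c x := fun h => hx₁' (by rw [h, hcc])
  have d23 : c e₁ ≠ e₂ := h₂₁'.symm
  have d24 : c e₁ ≠ c e₂ := fun h => h₂₁ (hinj h).symm
  have d25 : c e₁ ≠ x := hx₁'.symm
  have d26 : c e₁ ≠ c x := fun h => hx₁ (hinj h).symm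
  have d34 : e₂ ≠ c e₂ := (hc e₂).symm
  have d35 : e₂ ≠ x := hx₂.symm
  have d36 : e₂ ≠ c x := fun h => hx₂' (by rw [h, hcc])
  have d45 : c e₂ ≠ x := hx₂'.symm
  have d46 : c e₂ ≠ c x := fun h => hx₂ (hinj h).symm
  have d56 : x ≠ c x := (hc x).symm
  obtain ⟨b₁, b₂, b₃⟩ := b
  cases b₁ <;> cases b₂ <;> cases b₃ <;>
    simp [cmSetOf, d12, d13, d14, d15, d16, d23, d24, d25, d26, d34, d35, d36, d45, d46, d56,
      d12.symm, d13.symm, d14.symm, d15.symm, d16.symm, d23.symm, d24.symm, d25.symm, d26.symm, d34.symm, d35.symm, d36.symm,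
      d45.symm, d46.symm, d56.symm]

/-- `cmSetOf` is injective on `Bool³`. [folklore] -/
theorem cmSetOf_injective : Function.Injective (cmSetOf c e₁ e₂ x) := by
  intro b b' h
  obtain ⟨m1, -, m2, -, m3, -⟩ := mem_cmSetOf_iff hc hcc h₂₁ h₂₁' hx₁ hx₁' hx₂ hx₂' b
  obtain ⟨k1, -, k2, -, k3, -⟩ := mem_cmSetOf_iff hc hcc h₂₁ h₂₁' hx₁ hx₁' hx₂ hx₂' b'
  rw [h] at m1 m2 m3
  obtain ⟨b₁, b₂, b₃⟩ := b
  obtain ⟨b₁', b₂', b₃'⟩ := b'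
  simp only at m1 m2 m3 k1 k2 k3
  have e1 : b₁ = b₁' := by
    cases b₁ <;> cases b₁' <;> simp_all
  have e2 : b₂ = b₂' := by
    cases b₂ <;> cases b₂' <;> simp_all
  have e3 : b₃ = b₃' := by
    cases b₃ <;> cases b₃' <;> simp_all
  rw [e1, e2, e3]

end Pairs

section Count

variable [Fintype E] [DecidableEq E]

/-- Three representatives of the three pairs exist in a six-point `E`. [folklore] -/
theorem exists_three (c : E → E) (hE : Fintype.card E = 6) :
    ∃ e₁ e₂ x : E, e₂ ≠ e₁ ∧ e₂ ≠ c e₁ ∧ x ≠ e₁ ∧ x ≠ c e₁ ∧ x ≠ e₂ ∧ x ≠ c e₂ := by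
  obtain ⟨e₁⟩ : Nonempty E := Fintype.card_pos_iff.1 (by omega)
  have hex₂ : ∃ e₂ : E, e₂ ≠ e₁ ∧ e₂ ≠ c e₁ := by
    by_contra h
    push Not at h
    have hsub : (Finset.univ : Finset E) ⊆ {e₁, c e₁} := fun y _ => by
      rcases eq_or_ne y e₁ with rfl | hy
      · simp
      · simp [h y hy]
    have := Finset.card_le_card hsub
    rw [Finset.card_univ, hE] at this
    exact absurd (this.trans (Finset.card_insert_le _ _)) (by simp)
  obtain ⟨e₂, h₂₁, h₂₁'⟩ := hex₂
  have hex : ∃ x : E, x ≠ e₁ ∧ x ≠ c e₁ ∧ x ≠ e₂ ∧ x ≠ c e₂ := by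
    by_contra h
    push Not at h
    have hsub : (Finset.univ : Finset E) ⊆ {e₁, c e₁, e₂, c e₂} := fun y _ => by
      by_cases h1 : y = e₁; · simp [h1]
      by_cases h2 : y = c e₁; · simp [h2]
      by_cases h3 : y = e₂; · simp [h3]
      simp [h y h1 h2 h3]
    have := Finset.card_le_card hsub
    rw [Finset.card_univ, hE] at this
    have h4 : ({e₁, c e₁, e₂, c e₂} : Finset E).card ≤ 4 :=
      (Finset.card_insert_le _ _).trans (by
        have := (Finset.card_insert_le (c e₁) ({e₂, c e₂} : Finset E))
        have h2 : ({e₂, c e₂} : Finset E).card ≤ 2 := Finset.card_le_two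
        omega)
    omega
  obtain ⟨x, hx₁, hx₁', hx₂, hx₂'⟩ := hex
  exact ⟨e₁, e₂, x, h₂₁, h₂₁', hx₁, hx₁', hx₂, hx₂'⟩

variable (hE : Fintype.card E = 6) (hc : ∀ e : E, c e ≠ e) (hcc : ∀ e : E, c (c e) = e)
  {e₁ e₂ x : E} (h₂₁ : e₂ ≠ e₁) (h₂₁' : e₂ ≠ c e₁) (hx₁ : x ≠ e₁) (hx₁' : x ≠ c e₁) (hx₂ : x ≠ e₂) (hx₂' : x ≠ c e₂)
include hE hc hcc h₂₁ h₂₁' hx₁ hx₁' hx₂ hx₂'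

/-- Every `cmSetOf` is a CM set. [folklore] -/
theorem isCMSet_cmSetOf (b : Bool × Bool × Bool) : IsCMSet c (cmSetOf c e₁ e₂ x b) := by
  have six := eq_or_of_card_six hE hc hcc h₂₁ h₂₁' hx₁ hx₁' hx₂ hx₂'
  obtain ⟨m1, m1', m2, m2', m3, m3'⟩ := mem_cmSetOf_iff hc hcc h₂₁ h₂₁' hx₁ hx₁' hx₂ hx₂' b
  intro y
  rcases six y with rfl | rfl | rfl | rfl | rfl | rfl
  · rw [m1, m1']; simp
  · rw [m1', hcc, m1]; simp
  · rw [m2, m2']; simp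
  · rw [m2', hcc, m2]; simp
  · rw [m3, m3']; simp
  · rw [m3', hcc, m3]; simp

/-- Every CM set is a `cmSetOf`. [folklore] -/
theorem exists_eq_cmSetOf {Φ : Set E} (hΦ : IsCMSet c Φ) : ∃ b, Φ = cmSetOf c e₁ e₂ x b := by
  classical
  have six := eq_or_of_card_six hE hc hcc h₂₁ h₂₁' hx₁ hx₁' hx₂ hx₂'
  refine ⟨(decide (e₁ ∈ Φ), decide (e₂ ∈ Φ), decide (x ∈ Φ)), ?_⟩
  obtain ⟨m1, m1', m2, m2', m3, m3'⟩ :=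
    mem_cmSetOf_iff hc hcc h₂₁ h₂₁' hx₁ hx₁' hx₂ hx₂' (decide (e₁ ∈ Φ), decide (e₂ ∈ Φ), decide (x ∈ Φ))
  have n1 : c e₁ ∈ Φ ↔ e₁ ∉ Φ := ⟨fun h h1 => (hΦ e₁).1 h1 h, fun h => hΦ.apply_mem_of_not_mem h⟩
  have n2 : c e₂ ∈ Φ ↔ e₂ ∉ Φ := ⟨fun h h1 => (hΦ e₂).1 h1 h, fun h => hΦ.apply_mem_of_not_mem h⟩
  have n3 : c x ∈ Φ ↔ x ∉ Φ := ⟨fun h h1 => (hΦ x).1 h1 h, fun h => hΦ.apply_mem_of_not_mem h⟩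
  ext y
  rcases six y with rfl | rfl | rfl | rfl | rfl | rfl
  · rw [m1]; simp
  · rw [m1', n1]; simp
  · rw [m2]; simp
  · rw [m2', n2]; simp
  · rw [m3]; simp
  · rw [m3', n3]; simp

/-- **The CM sets are exactly the eight `cmSetOf b`.** [folklore] -/
theorem setOf_isCMSet_eq_range : {Φ : Set E | IsCMSet c Φ} = Set.range (cmSetOf c e₁ e₂ x) := by
  ext Φ
  constructor
  · intro hΦ
    obtain ⟨b, hb⟩ := exists_eq_cmSetOf hE hc hcc h₂₁ h₂₁' hx₁ hx₁' hx₂ hx₂' hΦ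
    exact ⟨b, hb.symm⟩
  · rintro ⟨b, rfl⟩
    exact isCMSet_cmSetOf hE hc hcc h₂₁ h₂₁' hx₁ hx₁' hx₂ hx₂' b

end Count

/-- **A six-point set with a fixed-point-free involution has exactly eight CM sets.** [folklore] -/
theorem ncard_setOf_isCMSet [Fintype E] [DecidableEq E] (hE : Fintype.card E = 6) (hc : ∀ e : E, c e ≠ e)
    (hcc : ∀ e : E, c (c e) = e) : {Φ : Set E | IsCMSet c Φ}.ncard = 8 := by
  obtain ⟨e₁, e₂, x, h₂₁, h₂₁', hx₁, hx₁', hx₂, hx₂'⟩ := exists_three c hE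
  rw [setOf_isCMSet_eq_range hE hc hcc h₂₁ h₂₁' hx₁ hx₁' hx₂ hx₂',
    Set.ncard_range_of_injective (cmSetOf_injective hc hcc h₂₁ h₂₁' hx₁ hx₁' hx₂ hx₂')]
  simp

/-- **Under single-pair flips on six points, the stabiliser of any CM set has index 8** (its orbit is all eight CM sets). [folklore] -/
theorem index_stabilizer_eq_eight [Fintype E] [DecidableEq E] (hE : Fintype.card E = 6) (hc : ∀ e : E, c e ≠ e)
    (hcc : ∀ e : E, c (c e) = e) (hcG : ∀ (g : G) (e : E), g • c e = c (g • e)) (hF : HasFlips G c) {Φ : Set E}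
    (hΦ : IsCMSet c Φ) : (MulAction.stabilizer G Φ).index = 8 := by
  rw [MulAction.index_stabilizer, orbit_eq_setOf_isCMSet hcG hF hΦ, ncard_setOf_isCMSet hE hc hcc]



end CMTypeFlips

namespace SignRecipe

open HodgeCM.CMTypeFlips

variable {K L : CMField}

/-- **At PerL's scope the stabiliser of `Ψ_L` in `Gal(L/ℚ)` has index 8** (the eight CM types of the sextic are ONE orbit). [folklore] -/
theorem index_stabilizer_pullbackTypeAlg (hN : IsNormalClosure ℚ K L) (hK : Module.finrank ℚ K = 6) (hL : 24 ≤ Module.finrank ℚ L)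
    (ι₁ : L →+* ℂ) (Ψ : CMType K) : (MulAction.stabilizer (L ≃ₐ[ℚ] L) (pullbackTypeAlg ι₁ Ψ)).index = 8 := by
  classical
  refine index_stabilizer_eq_eight ?_ embConj_ne embConj_embConj (fun σ ψ => smul_embConj σ ψ) (hasFlips_of_scope hN hK hL ι₁)
    (isCMSet_pullbackTypeAlg ι₁ Ψ)
  rw [card_algHom_of_isNormalClosure hN, hK]

/-- **The reflex field `K* = L^{Stab(Ψ_L)}` of EVERY CM type of a sextic has degree 8 over `ℚ` at PerL's scope** — so `K*` is never the
sextic `K` ([Dodson1984] §1 Reflex Degree Theorem, Remark; FLAG step (3) of STATUS 2026-08-20 l.13871, in the kernel). [folklore] -/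
theorem finrank_reflexField_pullbackTypeAlg (hN : IsNormalClosure ℚ K L) (hK : Module.finrank ℚ K = 6) (hL : 24 ≤ Module.finrank ℚ L)
    (ι₁ : L →+* ℂ) (Ψ : CMType K) : Module.finrank ℚ (reflexField ℚ L (pullbackTypeAlg ι₁ Ψ)) = 8 := by
  set H := MulAction.stabilizer (L ≃ₐ[ℚ] L) (pullbackTypeAlg ι₁ Ψ) with hH
  have hidx : H.index = 8 := index_stabilizer_pullbackTypeAlg hN hK hL ι₁ Ψ
  have htower : Module.finrank ℚ (reflexField ℚ L (pullbackTypeAlg ι₁ Ψ)) * Module.finrank (reflexField ℚ L (pullbackTypeAlg ι₁ Ψ)) L =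
      Module.finrank ℚ L := Module.finrank_mul_finrank ℚ _ L
  have hfix : Module.finrank (reflexField ℚ L (pullbackTypeAlg ι₁ Ψ)) L = Nat.card H := by
    rw [reflexField_eq_fixedField]
    exact IntermediateField.finrank_fixedField_eq_card H
  have hG : Nat.card H * H.index = Module.finrank ℚ L := by
    rw [Subgroup.card_mul_index, card_algEquiv_of_isNormalClosure hN]
  have hpos : 0 < Nat.card H := Nat.card_pos
  rw [hfix, ← hG, hidx, mul_comm] at htower
  exact Nat.eq_of_mul_eq_mul_left hpos htower

/-- … hence the reflex field of a CM type of the sextic is never of degree `[K:ℚ] = 6`. [folklore] -/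
theorem finrank_reflexField_pullbackTypeAlg_ne (hN : IsNormalClosure ℚ K L) (hK : Module.finrank ℚ K = 6) (hL : 24 ≤ Module.finrank ℚ L)
    (ι₁ : L →+* ℂ) (Ψ : CMType K) : Module.finrank ℚ (reflexField ℚ L (pullbackTypeAlg ι₁ Ψ)) ≠ Module.finrank ℚ K := by
  rw [finrank_reflexField_pullbackTypeAlg hN hK hL ι₁ Ψ, hK]
  decide

end SignRecipe

end HodgeCM

end
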